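import Literature.AlgebraicGeometry.HodgeTheory.DworkSexticEigenspaces
import Literature.AlgebraicGeometry.Motives.UniversalHypersurfaceFamily
import Literature.AlgebraicGeometry.Motives.HypersurfaceFormsNonsingular
import HarnessLib

/-!
# The `Γ_W`-invariant line of the Jacobian ring of the Dwork sextic: `R_{F_ψ}^{Γ_W}_{6j} = ℂ·ū^j ≠ 0`
# for every `ψ ∈ ℂ` and `j ≤ 4`

Family `hodge`, layer `Literature/AlgebraicGeometry/HodgeTheory`; theorems only (no definition, no named
fact; D-0026). Written for the crux `GenericInvariantHodgeClasses` (stmt-HodgeConjecture-24129) of route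
`HodgeConjecture/DworkReflectionQuotients`: the Jacobian-ring side of "the `Γ_W`-invariant part
`ℚ h² ⊕ H[0]` of `H⁴(X_ψ)` has Hodge numbers `1, (1,1,1,1,1)`" (Katz 2009, §3; through Griffiths'
`R_F^{6(q+1)−6} ≅ H^{4−q,q}_prim`, Voisin II Cor. 6.12) and of the non-degeneracy of the infinitesimal
variation of Hodge structure along the pencil (`∇̄_{∂/∂ψ}` = multiplication by `∂F_ψ/∂ψ = −6u` on the
Jacobian ring, Voisin II Thm. 6.13), AT EVERY POINT `ψ` of the line — not only generically.

For the Dwork form `F_ψ = Σ xᵢ⁶ − 6ψ ∏ xᵢ ∈ ℂ[x₀,…,x₅]` (`DworkSextic.form`), `u = ∏ xᵢ`, the Jacobian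
ideal `J(F_ψ) = (∂F_ψ/∂xᵢ)` (`Motives.UniversalHypersurface.jacobianIdeal`), and BALANCED exponents
`e ∈ ℕ⁶` — `eᵢ ≡ e₀ (mod 6)` for all `i`, i.e. `e = 6a + k𝟙`; these are exactly the exponents of the
monomials fixed by Katz's `Γ_W = {a ∈ μ₆⁶ : ∏ aᵢ = 1}` (sequel file):

* §1 `pderiv_form`, `monomial_mul_pderiv_form`, `monomial_mul_X_mul_pderiv_form` — the relations
  `x^m ∂ᵢF_ψ = 6x^{m+5eᵢ} − 6ψ x^{m+𝟙−eᵢ}` and `x^m xᵢ∂ᵢF_ψ = 6(x^{m+6eᵢ} − ψ x^{m+𝟙})`.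
* §2 `prod_X_pow_not_mem_jacobianIdeal` — **`u^j ∉ J(F_ψ)` for all `ψ ∈ ℂ` and `j ≤ 4`**, by the
  Macaulay-inverse-system functional `φ_j(x^{6a + k𝟙}) = ψ^{|a|}` (`|a| + k = j`), `φ_j = 0` off the
  balanced exponents of degree `6j`, which kills `x^m ∂ᵢF_ψ` for every `m` (for `j ≤ 4` a balanced
  exponent `6a + k𝟙` of degree `6j` with `i`-th entry `≥ 5` has `aᵢ ≥ 1`), and `φ_j(u^j) = 1`.
* §3 `monomial_sub_C_mul_prod_X_pow_mem_jacobianIdeal` — **every balanced monomial `x^e`, `e = 6a + k𝟙`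
  of degree `6j ≤ 24`, satisfies `x^e ≡ ψ^{|a|} u^j (mod J(F_ψ))`**; with §2: the balanced part of
  `ℂ[x]_{6j}` maps ONTO the line `ℂ·ū^j ≠ 0` of `R_{F_ψ}`.

`-- TODO(general form): the same functional proves u^j ∉ J(Σ xᵢ^d − dψ∏xᵢ), j ≤ d − 2, in d variables.`

## References

* [Katz2009] N. M. Katz, Another look at the Dwork family, Progr. Math. 270 (2009), §3, §8.
* [VoisinHodgeII2003] C. Voisin, Hodge Theory and Complex Algebraic Geometry II (2003), §6.1.2 Def. 6.9,
  Cor. 6.12, §6.1.3 Thm. 6.13, §6.2.2 Thm. 6.19 (Macaulay).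
* [CarlsonGriffiths1980] J. Carlson, P. Griffiths, Infinitesimal variations of Hodge structure and the
  global Torelli problem, Journées de géométrie algébrique d'Angers (1980), §3.
-/

noncomputable section

open MvPolynomial Finset
open scoped BigOperators

namespace Literature.AlgebraicGeometry.HodgeTheory.DworkSextic

open Literature.AlgebraicGeometry.Motives Literature.AlgebraicGeometry.Motives.UniversalHypersurface

/-! ### §1 The partial derivatives of the Dwork form -/

/-- The all-ones exponent `𝟙 = Σ_l e_l` (exponent of `u = ∏ xᵢ`) has every entry `1`. [folklore] -/
private theorem sum_single_one_apply (i : Fin 6) :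
    (∑ l : Fin 6, Finsupp.single l 1 : Fin 6 →₀ ℕ) i = 1 := by
  rw [Finsupp.finsetSum_apply, Finset.sum_eq_single i (fun l _ hli => by
    rw [Finsupp.single_apply, if_neg hli]) (fun h => absurd (Finset.mem_univ i) h),
    Finsupp.single_eq_same]

/-- `u^j = (∏ xᵢ)^j` is the monomial `x^{j𝟙}` (Katz's `X^{jW}`, `W = 𝟙`). [cite: Katz2009, §3] -/
theorem prod_X_pow_eq_monomial (j : ℕ) :
    (∏ i : Fin 6, X i : MvPolynomial (Fin 6) ℂ) ^ j = monomial (j • ∑ l : Fin 6, Finsupp.single l 1) 1 := by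
  rw [prod_X_eq_monomial, monomial_pow, one_pow]

/-- **`∂F_ψ/∂xᵢ = 6xᵢ⁵ − 6ψ ∏_{l ≠ i} x_l`** in monomial form (Katz, proof of Lemma 2.1).
[cite: Katz2009, Lemma 2.1 (proof)] -/
theorem pderiv_form (ψ : ℂ) (i : Fin 6) :
    pderiv i (form ψ) = C 6 * monomial (Finsupp.single i 5) 1
      - C (6 * ψ) * monomial ((∑ l : Fin 6, Finsupp.single l 1) - Finsupp.single i 1) 1 := by
  have hS : pderiv i (∑ l : Fin 6, (X l : MvPolynomial (Fin 6) ℂ) ^ 6) =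
      C 6 * monomial (Finsupp.single i 5) 1 := by
    rw [SmoothHypersurface.pderiv_sum_X_pow, X_pow_eq_monomial,
      ← map_natCast (C : ℂ →+* MvPolynomial (Fin 6) ℂ) 6]
    norm_num
  have hP : pderiv i (∏ l : Fin 6, (X l : MvPolynomial (Fin 6) ℂ)) =
      monomial ((∑ l : Fin 6, Finsupp.single l 1) - Finsupp.single i 1) 1 := by
    rw [prod_X_eq_monomial, pderiv_monomial, sum_single_one_apply, Nat.cast_one, one_mul]
  show pderiv i ((∑ l : Fin 6, (X l : MvPolynomial (Fin 6) ℂ) ^ 6) - C (6 * ψ) * ∏ l : Fin 6, X l) = _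
  rw [map_sub, pderiv_C_mul, hS, hP]

/-- **`x^m · ∂F_ψ/∂xᵢ = 6·x^{m+5eᵢ} − 6ψ·x^{m+𝟙−eᵢ}`** (the generators of `J(F_ψ)` as a `ℂ`-vector
space). [cite: VoisinHodgeII2003, §6.1.2 Def. 6.9] -/
theorem monomial_mul_pderiv_form (ψ : ℂ) (i : Fin 6) (m : Fin 6 →₀ ℕ) :
    monomial m 1 * pderiv i (form ψ) =
      C 6 * monomial (m + Finsupp.single i 5) 1
        - C (6 * ψ) * monomial (m + ((∑ l : Fin 6, Finsupp.single l 1) - Finsupp.single i 1)) 1 := by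
  rw [pderiv_form, mul_sub, mul_left_comm _ (C 6), monomial_mul, one_mul,
    mul_left_comm _ (C (6 * ψ)), monomial_mul, one_mul]

/-- **`x^m · xᵢ ∂F_ψ/∂xᵢ = 6·(x^{m+6eᵢ} − ψ·x^{m+𝟙})`**: in the Jacobian ring `xᵢ⁶ ≡ ψu` times any
monomial (Katz, §3: the relation `Xᵢ d/dXᵢ`). [cite: Katz2009, Lemma 2.1 (proof)] -/
theorem monomial_mul_X_mul_pderiv_form (ψ : ℂ) (i : Fin 6) (m : Fin 6 →₀ ℕ) :
    monomial m 1 * (X i * pderiv i (form ψ)) =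
      C 6 * (monomial (m + Finsupp.single i 6) 1
        - C ψ * monomial (m + ∑ l : Fin 6, Finsupp.single l 1) 1) := by
  rw [X_mul_pderiv_form, mul_left_comm, mul_sub, X_pow_eq_monomial, monomial_mul, one_mul,
    mul_left_comm _ (C ψ), prod_X_eq_monomial, monomial_mul, one_mul]

/-! ### §2 The functional `φ_j` and `u^j ∉ J(F_ψ)` -/

/-- A coefficient functional `P ↦ Σ_{f ∈ T} W(f)·coeff_f(P)` on a monomial. [folklore] -/
private theorem sum_mul_coeff_monomial (T : Finset (Fin 6 → ℕ)) (W : (Fin 6 → ℕ) → ℂ)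
    (e : Fin 6 →₀ ℕ) (c : ℂ) :
    (∑ f ∈ T, W f * coeff (Finsupp.equivFunOnFinite.symm f) (monomial e c)) =
      if (⇑e) ∈ T then W e * c else 0 := by
  classical
  have hterm : ∀ f : Fin 6 → ℕ, W f * coeff (Finsupp.equivFunOnFinite.symm f) (monomial e c) =
      if f = ⇑e then W e * c else 0 := by
    intro f
    rw [coeff_monomial]
    by_cases hf : f = ⇑e
    · subst hf
      rw [if_pos (Finsupp.equivFunOnFinite_symm_coe e).symm, if_pos rfl]
    · rw [if_neg, if_neg hf, mul_zero]
      intro h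
      exact hf (by rw [h, Finsupp.coe_equivFunOnFinite_symm])
  simp_rw [hterm]
  rw [Finset.sum_ite_eq' T (⇑e)]

/-- The coefficient functional is additive. [folklore] -/
private theorem sum_mul_coeff_add (T : Finset (Fin 6 → ℕ)) (W : (Fin 6 → ℕ) → ℂ) (p q : MvPolynomial (Fin 6) ℂ) :
    (∑ f ∈ T, W f * coeff (Finsupp.equivFunOnFinite.symm f) (p + q)) =
      (∑ f ∈ T, W f * coeff (Finsupp.equivFunOnFinite.symm f) p) +
        ∑ f ∈ T, W f * coeff (Finsupp.equivFunOnFinite.symm f) q := by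
  simp only [coeff_add, mul_add, Finset.sum_add_distrib]

/-- The coefficient functional commutes with finite sums. [folklore] -/
private theorem sum_mul_coeff_sum (T : Finset (Fin 6 → ℕ)) (W : (Fin 6 → ℕ) → ℂ) {ι : Type*} (s : Finset ι)
    (g : ι → MvPolynomial (Fin 6) ℂ) :
    (∑ f ∈ T, W f * coeff (Finsupp.equivFunOnFinite.symm f) (∑ i ∈ s, g i)) =
      ∑ i ∈ s, ∑ f ∈ T, W f * coeff (Finsupp.equivFunOnFinite.symm f) (g i) := by
  simp only [coeff_sum, Finset.mul_sum]
  rw [Finset.sum_comm]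

/-- The coefficient functional is `ℂ`-linear: `φ(C c · P) = c·φ(P)`. [folklore] -/
private theorem sum_mul_coeff_C_mul (T : Finset (Fin 6 → ℕ)) (W : (Fin 6 → ℕ) → ℂ) (c : ℂ)
    (p : MvPolynomial (Fin 6) ℂ) :
    (∑ f ∈ T, W f * coeff (Finsupp.equivFunOnFinite.symm f) (C c * p)) =
      c * ∑ f ∈ T, W f * coeff (Finsupp.equivFunOnFinite.symm f) p := by
  simp only [coeff_C_mul, Finset.mul_sum]
  exact Finset.sum_congr rfl fun f _ => by ring

/-- `φ(P − C c · Q) = φ(P) − c·φ(Q)`. [folklore] -/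
private theorem sum_mul_coeff_sub_C_mul (T : Finset (Fin 6 → ℕ)) (W : (Fin 6 → ℕ) → ℂ) (c : ℂ)
    (p q : MvPolynomial (Fin 6) ℂ) :
    (∑ f ∈ T, W f * coeff (Finsupp.equivFunOnFinite.symm f) (p - C c * q)) =
      (∑ f ∈ T, W f * coeff (Finsupp.equivFunOnFinite.symm f) p) -
        c * ∑ f ∈ T, W f * coeff (Finsupp.equivFunOnFinite.symm f) q := by
  rw [sub_eq_add_neg, show -(C c * q) = C (-c) * q by rw [map_neg, neg_mul], sum_mul_coeff_add,
    sum_mul_coeff_C_mul]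
  ring

/-- **The arithmetic of the two exponents of `x^m ∂ᵢF_ψ`**: `e₁ = m + 5eᵢ` and `e₂ = m + 𝟙 − eᵢ`
satisfy `e₂ ≡ e₁ + 𝟙 (mod 6)`; if `e₁ = 6a + k𝟙` is balanced of degree `6j`, `j ≤ 4`, with `i`-th entry
`≥ 5`, then `aᵢ ≥ 1`, so `e₂ = 6(a − eᵢ) + (k+1)𝟙` with `k + 1 ≤ j`: the `φ_j`-exponents satisfy
`j − k = (j − (k+1)) + 1`. [cite: VoisinHodgeII2003, §6.2.2] -/
theorem weight_shift {j : ℕ} (hj : j ≤ 4) (i : Fin 6) (e₁ e₂ : Fin 6 → ℕ)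
    (h : ∀ l, (e₁ l + 1) % 6 = e₂ l % 6) (hi : 5 ≤ e₁ i) (hdeg : ∑ l, e₁ l = 6 * j)
    (hbal : ∀ l, e₁ l % 6 = e₁ 0 % 6) :
    j - e₁ 0 % 6 = (j - e₂ 0 % 6) + 1 := by
  have h0 := h 0
  have hbi := hbal i
  have hsplit : ∑ l, e₁ l = e₁ i + ∑ l ∈ Finset.univ.erase i, e₁ l :=
    (Finset.add_sum_erase _ _ (Finset.mem_univ i)).symm
  have hrest : 5 * (e₁ 0 % 6) ≤ ∑ l ∈ Finset.univ.erase i, e₁ l :=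
    calc 5 * (e₁ 0 % 6) = ∑ l ∈ Finset.univ.erase i, e₁ 0 % 6 := by
          rw [Finset.sum_const, Finset.card_erase_of_mem (Finset.mem_univ i), Finset.card_univ,
            Fintype.card_fin, smul_eq_mul]
      _ ≤ ∑ l ∈ Finset.univ.erase i, e₁ l :=
          Finset.sum_le_sum fun l _ => by rw [← hbal l]; exact Nat.mod_le _ _
  omega

/-- **`φ_j` kills the generators `x^m ∂ᵢF_ψ` of `J(F_ψ)`** (`j ≤ 4`, every `m`, every `i`), where
`φ_j(x^f) = ψ^{j − (f₀ mod 6)}` for `f` balanced of degree `6j` and `0` otherwise.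
[cite: VoisinHodgeII2003, §6.2.2 Thm. 6.19] -/
theorem phi_monomial_mul_pderiv_form (ψ : ℂ) {j : ℕ} (hj : j ≤ 4) (i : Fin 6) (m : Fin 6 →₀ ℕ) :
    (∑ f ∈ Finset.Nat.antidiagonalTuple 6 (6 * j),
        (if (∀ l : Fin 6, f l % 6 = f 0 % 6) then ψ ^ (j - f 0 % 6) else 0) *
          coeff (Finsupp.equivFunOnFinite.symm f) (monomial m 1 * pderiv i (form ψ))) = 0 := by
  set e₁ : Fin 6 →₀ ℕ := m + Finsupp.single i 5 with he₁
  set e₂ : Fin 6 →₀ ℕ := m + ((∑ l : Fin 6, Finsupp.single l 1) - Finsupp.single i 1) with he₂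
  rw [monomial_mul_pderiv_form, sum_mul_coeff_sub_C_mul, sum_mul_coeff_C_mul, sum_mul_coeff_monomial,
    sum_mul_coeff_monomial, mul_one, mul_one]
  -- the values of the two exponents
  have hv₁ : ∀ l, e₁ l = m l + if i = l then 5 else 0 := fun l => by
    rw [he₁, Finsupp.add_apply, Finsupp.single_apply]
  have hv₂ : ∀ l, e₂ l = m l + if i = l then 0 else 1 := fun l => by
    rw [he₂, Finsupp.add_apply, Finsupp.tsub_apply, sum_single_one_apply, Finsupp.single_apply]
    split_ifs <;> rfl
  have hshift : ∀ l, (e₁ l + 1) % 6 = e₂ l % 6 := fun l => by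
    rw [hv₁, hv₂]
    split_ifs <;> omega
  have hi : 5 ≤ e₁ i := by rw [hv₁, if_pos rfl]; omega
  have hdeg : ∑ l, e₁ l = ∑ l, e₂ l := by
    have h1 : ∑ l, e₁ l = ∑ l : Fin 6, m l + 5 := by
      rw [Finset.sum_congr rfl fun l _ => hv₁ l, Finset.sum_add_distrib,
        Finset.sum_ite_eq Finset.univ i, if_pos (Finset.mem_univ i)]
    have h2 : ∑ l, e₂ l = ∑ l : Fin 6, m l + 5 := by
      rw [Finset.sum_congr rfl fun l _ => hv₂ l, Finset.sum_add_distrib]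
      congr 1
      rw [Finset.sum_ite, Finset.sum_const_zero, zero_add, Finset.sum_const, smul_eq_mul, mul_one,
        Finset.filter_ne, Finset.card_erase_of_mem (Finset.mem_univ i), Finset.card_univ,
        Fintype.card_fin]
    rw [h1, h2]
  -- membership in the index set and balancedness agree for `e₁`, `e₂`
  have hmem : (⇑e₁ ∈ Finset.Nat.antidiagonalTuple 6 (6 * j)) ↔
      (⇑e₂ ∈ Finset.Nat.antidiagonalTuple 6 (6 * j)) := by
    rw [Finset.Nat.mem_antidiagonalTuple, Finset.Nat.mem_antidiagonalTuple, hdeg]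
  have hbal : (∀ l : Fin 6, e₁ l % 6 = e₁ 0 % 6) ↔ (∀ l : Fin 6, e₂ l % 6 = e₂ 0 % 6) := by
    have h0 := hshift 0
    constructor
    · intro hb l
      have h1 := hshift l
      have h2 := hb l
      omega
    · intro hb l
      have h1 := hshift l
      have h2 := hb l
      omega
  by_cases hT : (⇑e₁ ∈ Finset.Nat.antidiagonalTuple 6 (6 * j))
  · rw [if_pos hT, if_pos (hmem.mp hT)]
    by_cases hb : ∀ l : Fin 6, e₁ l % 6 = e₁ 0 % 6
    · have hb₂ : ∀ l : Fin 6, (⇑e₂) l % 6 = (⇑e₂) 0 % 6 := hbal.mp hb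
      rw [if_pos hb, if_pos hb₂,
        weight_shift hj i e₁ e₂ hshift hi (Finset.Nat.mem_antidiagonalTuple.mp hT) hb, pow_succ]
      ring
    · have hb₂ : ¬ ∀ l : Fin 6, (⇑e₂) l % 6 = (⇑e₂) 0 % 6 := fun h => hb (hbal.mpr h)
      rw [if_neg hb, if_neg hb₂]
      ring
  · rw [if_neg hT, if_neg (fun h => hT (hmem.mpr h))]
    ring

/-- **`φ_j` kills the Jacobian ideal `J(F_ψ)`** (`j ≤ 4`): `J(F_ψ) = Σᵢ ℂ[x]·∂ᵢF_ψ`, expand each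
coefficient polynomial in monomials. [cite: VoisinHodgeII2003, §6.1.2 Def. 6.9] -/
theorem phi_eq_zero_of_mem_jacobianIdeal (ψ : ℂ) {j : ℕ} (hj : j ≤ 4) {p : MvPolynomial (Fin 6) ℂ}
    (hp : p ∈ jacobianIdeal (form ψ)) :
    (∑ f ∈ Finset.Nat.antidiagonalTuple 6 (6 * j),
        (if (∀ l : Fin 6, f l % 6 = f 0 % 6) then ψ ^ (j - f 0 % 6) else 0) *
          coeff (Finsupp.equivFunOnFinite.symm f) p) = 0 := by
  rw [jacobianIdeal, Ideal.mem_span_range_iff_exists_fun] at hp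
  obtain ⟨c, rfl⟩ := hp
  have hmul : ∀ (i : Fin 6) (g : MvPolynomial (Fin 6) ℂ),
      (∑ f ∈ Finset.Nat.antidiagonalTuple 6 (6 * j),
        (if (∀ l : Fin 6, f l % 6 = f 0 % 6) then ψ ^ (j - f 0 % 6) else 0) *
          coeff (Finsupp.equivFunOnFinite.symm f) (g * pderiv i (form ψ))) = 0 := by
    intro i g
    induction g using MvPolynomial.induction_on' with
    | monomial u a =>
      rw [show monomial u a = C a * monomial u 1 by rw [C_mul_monomial, mul_one], mul_assoc,
        sum_mul_coeff_C_mul, phi_monomial_mul_pderiv_form ψ hj, mul_zero]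
    | add p q hp hq => rw [add_mul, sum_mul_coeff_add, hp, hq, add_zero]
  rw [sum_mul_coeff_sum]
  exact Finset.sum_eq_zero fun i _ => hmul i (c i)

/-- **For every `ψ ∈ ℂ` and every `j ≤ 4`, `u^j = (∏ xᵢ)^j ∉ J(F_ψ)`.** The functional `φ_j` kills
`J(F_ψ)` and `φ_j(u^j) = ψ⁰ = 1`. For `j = 4` this is the non-vanishing of the socle generator
`ū⁴ ∈ R_{F_ψ}^{24}` on the invariant line; for `j ≤ 3`, with §3, the non-degeneracy of
`∇̄_{∂/∂ψ} : R^{Γ_W}_{6j} → R^{Γ_W}_{6j+6}` (`ū^j ↦ −6ū^{j+1} ≠ 0`) at every point of the Dwork line.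
[cite: VoisinHodgeII2003, Cor. 6.12 and Thm. 6.13] [cite: Katz2009, §3] -/
theorem prod_X_pow_not_mem_jacobianIdeal (ψ : ℂ) {j : ℕ} (hj : j ≤ 4) :
    (∏ i : Fin 6, X i : MvPolynomial (Fin 6) ℂ) ^ j ∉ jacobianIdeal (form ψ) := by
  intro hmem
  have h0 := phi_eq_zero_of_mem_jacobianIdeal ψ hj hmem
  rw [prod_X_pow_eq_monomial, sum_mul_coeff_monomial, mul_one] at h0
  have hval : ∀ l, (j • ∑ l : Fin 6, Finsupp.single l 1 : Fin 6 →₀ ℕ) l = j := fun l => by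
    rw [Finsupp.smul_apply, sum_single_one_apply, smul_eq_mul, mul_one]
  have hT : (⇑(j • ∑ l : Fin 6, Finsupp.single l 1 : Fin 6 →₀ ℕ)) ∈
      Finset.Nat.antidiagonalTuple 6 (6 * j) := by
    rw [Finset.Nat.mem_antidiagonalTuple, Finset.sum_congr rfl fun l _ => hval l, Finset.sum_const,
      Finset.card_univ, Fintype.card_fin, smul_eq_mul]
  have hb : ∀ l : Fin 6, (⇑(j • ∑ l : Fin 6, Finsupp.single l 1 : Fin 6 →₀ ℕ)) l % 6 =
      (⇑(j • ∑ l : Fin 6, Finsupp.single l 1 : Fin 6 →₀ ℕ)) 0 % 6 := fun l => by rw [hval, hval]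
  rw [if_pos hT, if_pos hb, hval, Nat.mod_eq_of_lt (by omega), Nat.sub_self, pow_zero] at h0
  exact one_ne_zero h0

/-- In particular `u³ = u·u² ∉ J(F_ψ)` (the step `Gr²_F → Gr¹_F` of the infinitesimal variation on the
invariant piece) for every `ψ`. [cite: Katz2009, §3] -/
theorem prod_X_pow_three_not_mem_jacobianIdeal (ψ : ℂ) :
    (∏ i : Fin 6, X i : MvPolynomial (Fin 6) ℂ) ^ 3 ∉ jacobianIdeal (form ψ) :=
  prod_X_pow_not_mem_jacobianIdeal ψ (by norm_num)

/-! ### §3 Balanced monomials reduce to the invariant line `ℂ·u^j` -/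

/-- **Every balanced monomial of degree `6j ≤ 24` is `ψ^{|a|} u^j` modulo `J(F_ψ)`**: for
`e = 6a + k𝟙` (all `eᵢ ≡ k = e₀ mod 6`, `|a| + k = j ≤ 4`),
`x^e − ψ^{j−k}·u^j ∈ J(F_ψ)` — induction on `|a|`, peeling one `xᵢ⁶ ≡ ψu` at a time
(`monomial_mul_X_mul_pderiv_form`). Hence the balanced part of `ℂ[x]_{6j}` maps onto `ℂ·ū^j` in
`R_{F_ψ}` (Katz, §3: the `Γ_W`-invariant piece has rank one in each Hodge degree).
[cite: Katz2009, §3 and Lemma 3.1] [cite: VoisinHodgeII2003, Cor. 6.12] -/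
theorem monomial_sub_C_mul_prod_X_pow_mem_jacobianIdeal (ψ : ℂ) {j : ℕ} (hj : j ≤ 4)
    (e : Fin 6 →₀ ℕ) (hbal : ∀ l : Fin 6, e l % 6 = e 0 % 6) (hdeg : ∑ l : Fin 6, e l = 6 * j) :
    monomial e 1 - C (ψ ^ (j - e 0 % 6)) * (∏ i : Fin 6, X i : MvPolynomial (Fin 6) ℂ) ^ j
      ∈ jacobianIdeal (form ψ) := by
  obtain ⟨n, hn⟩ : ∃ n, j - e 0 % 6 = n := ⟨_, rfl⟩
  rw [hn]
  induction n generalizing e with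
  | zero =>
    -- `|a| = 0`: `e = j𝟙` and the difference vanishes
    have hge : ∀ l, j ≤ e l := fun l => by
      have h1 := hbal l
      have h2 := Nat.mod_le (e l) 6
      omega
    have hall := (Finset.sum_eq_sum_iff_of_le (s := Finset.univ) (f := fun _ : Fin 6 => j) (g := ⇑e)
      (fun l _ => hge l)).mp (by
        rw [Finset.sum_const, Finset.card_univ, Fintype.card_fin, smul_eq_mul, hdeg])
    have he : e = j • ∑ l : Fin 6, Finsupp.single l 1 := by
      ext l
      rw [Finsupp.smul_apply, sum_single_one_apply, smul_eq_mul, mul_one]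
      exact (hall l (Finset.mem_univ l)).symm
    rw [he, ← prod_X_pow_eq_monomial, pow_zero, C_1, one_mul, sub_self]
    exact Ideal.zero_mem _
  | succ n ih =>
    -- some entry is `≥ 6`
    obtain ⟨i, hi⟩ : ∃ i, 6 ≤ e i := by
      by_contra h
      have h' : ∀ l, e l < 6 := fun l => not_le.mp fun hl => h ⟨l, hl⟩
      have hk : ∀ l, e l = e 0 % 6 := fun l => by rw [← hbal l, Nat.mod_eq_of_lt (h' l)]
      have hs : ∑ l, e l = 6 * (e 0 % 6) := by
        rw [Finset.sum_congr rfl fun l _ => hk l, Finset.sum_const, Finset.card_univ, Fintype.card_fin,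
          smul_eq_mul]
      omega
    set m : Fin 6 →₀ ℕ := e - Finsupp.single i 6 with hm
    have hme : m + Finsupp.single i 6 = e := by
      rw [hm]
      exact tsub_add_cancel_of_le (fun l => by
        rw [Finsupp.single_apply]
        split_ifs with h
        · exact h ▸ hi
        · exact Nat.zero_le _)
    set e' : Fin 6 →₀ ℕ := m + ∑ l : Fin 6, Finsupp.single l 1 with he'
    have hv : ∀ l, e' l + (if i = l then 6 else 0) = e l + 1 := fun l => by
      have h1 : m l + (if i = l then 6 else 0) = e l := by
        have := congrArg (fun f : Fin 6 →₀ ℕ => f l) hme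
        simpa only [Finsupp.add_apply, Finsupp.single_apply] using this
      have h2 : e' l = m l + 1 := by
        rw [he', Finsupp.add_apply, sum_single_one_apply]
      omega
    have hbal' : ∀ l : Fin 6, e' l % 6 = e' 0 % 6 := fun l => by
      have hl := hv l
      have h0 := hv 0
      have hb := hbal l
      split_ifs at hl h0 <;> omega
    have hdeg' : ∑ l : Fin 6, e' l = 6 * j := by
      have hsum : ∑ l, (e' l + if i = l then 6 else 0) = ∑ l, (e l + 1) :=
        Finset.sum_congr rfl fun l _ => hv l
      rw [Finset.sum_add_distrib, Finset.sum_add_distrib, Finset.sum_ite_eq Finset.univ i,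
        if_pos (Finset.mem_univ i), Finset.sum_const, Finset.card_univ, Fintype.card_fin, smul_eq_mul,
        mul_one, hdeg] at hsum
      omega
    have hn' : j - e' 0 % 6 = n := by
      have v0 := hv 0
      split_ifs at v0 <;> omega
    have hIH := ih e' hbal' hdeg' hn'
    -- the relation `x^e − ψ x^{e'} ∈ J(F_ψ)`
    have hrel : monomial e 1 - C ψ * monomial e' 1 ∈ jacobianIdeal (form ψ) := by
      have hJ : monomial m 1 * (X i * pderiv i (form ψ)) ∈ jacobianIdeal (form ψ) := by
        rw [← mul_assoc]
        exact Ideal.mul_mem_left _ _ (pderiv_mem_jacobianIdeal (form ψ) i)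
      rw [monomial_mul_X_mul_pderiv_form, hme] at hJ
      have h := Ideal.mul_mem_left _ (C (6 : ℂ)⁻¹) hJ
      rwa [← mul_assoc, ← map_mul, inv_mul_cancel₀ (by norm_num : (6 : ℂ) ≠ 0), map_one,
        one_mul] at h
    have hcomb : monomial e 1 - C (ψ ^ (n + 1)) * (∏ i : Fin 6, X i : MvPolynomial (Fin 6) ℂ) ^ j =
        (monomial e 1 - C ψ * monomial e' 1) +
          C ψ * (monomial e' 1 - C (ψ ^ n) * (∏ i : Fin 6, X i : MvPolynomial (Fin 6) ℂ) ^ j) := by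
      rw [pow_succ, map_mul]
      ring
    rw [hcomb]
    exact Ideal.add_mem _ hrel (Ideal.mul_mem_left _ _ hIH)

end Literature.AlgebraicGeometry.HodgeTheory.DworkSextic

end
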